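import Literature.Geometry.Lorentzian.CoordFormCauchySchwarz
import HarnessLib

/-!
# Pointwise Cauchy–Schwarz for covectors and bilinear forms against vectors, in coordinates

Topic `Literature/Geometry/Lorentzian`, coordinate tensor calculus `MetricCoord`: linear algebra at
ONE point `x` of an open set `V` carrying metric components `G` (`IsMetricOn G V`) at which `G x`
is positive definite, read in a `G x`-orthonormal basis (`exists_orthonormal_basis`). Everything here
is PROVED; no definition and no statement of `Prop` type is introduced.

* `covector_apply_eq_sum_frame` — `φ(v) = Σ_p G(v,e_p) φ(e_p)`;
* `covector_apply_sq_le` — **`φ(v)² ≤ φ(♯φ) G(v,v)`** (with `φ = df`: `df(Y)² ≤ |∇f|² |Y|²`);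
* `apply_sq_le_normSqAt_mul` — **`β(v,w)² ≤ |β|²_G G(v,v) G(w,w)`** (`|β|²_G = normSqAt`);
* `abs_le_peterPaul` — `c² ≤ ab`, `a, b ≥ 0`, `λ > 0` give `|c| ≤ ½(λa + λ⁻¹b)`.

Support file for the weighted Korn-type inequality (5.12) of Chruściel–Delay 2003
(`CoordWeightedKornBoundary.lean`).

## References

* B. O'Neill, *Semi-Riemannian geometry*, 1983, Ch. 2, Lemma 2.25 (orthonormal expansion).
  [ONeill1983]
-/

noncomputable section

set_option maxSynthPendingDepth 3

open Set Filter Module Function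

namespace Literature.Geometry.Lorentzian

namespace MetricCoord

variable {E : Type*} [NormedAddCommGroup E] [NormedSpace ℝ E] [FiniteDimensional ℝ E]
  {G : E → E →L[ℝ] E →L[ℝ] ℝ} {V : Set E} {x : E}

/-! ### Pointwise Cauchy–Schwarz at a positive definite point -/

section CauchySchwarz

variable {κ : Type*} [Fintype κ] [DecidableEq κ] (e : Basis κ ℝ E)
  (he : ∀ i j, G x (e i) (e j) = if i = j then 1 else 0)
include he

omit [FiniteDimensional ℝ E] in
/-- `φ(v) = Σ_p G(v, e_p) φ(e_p)` in a `G x`-orthonormal basis. [cite: ONeill1983, Ch. 2, Lemma 2.25] -/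
theorem covector_apply_eq_sum_frame (φ : E →L[ℝ] ℝ) (v : E) :
    φ v = ∑ p, G x v (e p) * φ (e p) := by
  conv_lhs => rw [← sum_apply_smul_of_orthonormal e he v]
  simp only [map_sum, map_smul, smul_eq_mul]

end CauchySchwarz

/-- **Cauchy–Schwarz for a covector**: `φ(v)² ≤ φ(♯φ) G(v,v)` at a symmetric positive definite
point. [cite: ONeill1983, Ch. 2, Lemma 2.25] -/
theorem covector_apply_sq_le (hG : IsMetricOn G V) (hx : x ∈ V)
    (hpos : ∀ v : E, v ≠ 0 → 0 < G x v v) (φ : E →L[ℝ] ℝ) (v : E) :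
    φ v ^ 2 ≤ φ (sharpAt G x φ) * G x v v := by
  have hi := hG.isInvertible x hx
  have hs := hG.symm x hx
  obtain ⟨e, he⟩ := exists_orthonormal_basis hs hpos
  have hv : G x v v = ∑ p, G x v (e p) ^ 2 := by
    rw [bilin_apply_eq_sum_frame e he (G x) v v]
    exact Finset.sum_congr rfl fun p _ ↦ by rw [hs (e p) v, sq]
  have hφ : φ (sharpAt G x φ) = ∑ p, φ (e p) ^ 2 := by
    rw [apply_sharpAt_eq_sum_frame e he hi hs]
    exact Finset.sum_congr rfl fun p _ ↦ by rw [sq]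
  rw [covector_apply_eq_sum_frame e he φ v, hv, hφ, mul_comm]
  exact Finset.sum_mul_sq_le_sq_mul_sq _ _ _

/-- **Cauchy–Schwarz for a bilinear form against two vectors**:
`β(v,w)² ≤ |β|²_G G(v,v) G(w,w)` at a symmetric positive definite point (`|β|²_G = normSqAt`).
[cite: ONeill1983, Ch. 2, Lemma 2.25] -/
theorem apply_sq_le_normSqAt_mul (hG : IsMetricOn G V) (hx : x ∈ V)
    (hpos : ∀ v : E, v ≠ 0 → 0 < G x v v) (β : E →L[ℝ] E →L[ℝ] ℝ) (v w : E) :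
    β v w ^ 2 ≤ normSqAt G x β * (G x v v * G x w w) := by
  have hi := hG.isInvertible x hx
  have hs := hG.symm x hx
  obtain ⟨e, he⟩ := exists_orthonormal_basis hs hpos
  have hv : G x v v = ∑ p, G x v (e p) ^ 2 := by
    rw [bilin_apply_eq_sum_frame e he (G x) v v]
    exact Finset.sum_congr rfl fun p _ ↦ by rw [hs (e p) v, sq]
  have hw : G x w w = ∑ q, G x w (e q) ^ 2 := by
    rw [bilin_apply_eq_sum_frame e he (G x) w w]
    exact Finset.sum_congr rfl fun q _ ↦ by rw [hs (e q) w, sq]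
  have hβ : β v w = ∑ p, ∑ q, (G x v (e p) * G x w (e q)) * β (e p) (e q) := by
    rw [bilin_apply_eq_sum_frame e he β v w]
    refine Finset.sum_congr rfl fun p _ ↦ ?_
    rw [covector_apply_eq_sum_frame e he (β (e p)) w, Finset.mul_sum]
    exact Finset.sum_congr rfl fun q _ ↦ by ring
  have hflat : ∀ f : Fin (finrank ℝ E) → Fin (finrank ℝ E) → ℝ,
      ∑ i, ∑ j, f i j = ∑ p : Fin (finrank ℝ E) × Fin (finrank ℝ E), f p.1 p.2 :=
    fun f ↦ (Fintype.sum_prod_type' f).symm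
  rw [hβ, normSqAt_eq_sum_frame e he hi hs β, hv, hw, hflat, hflat, Fintype.sum_mul_sum,
    ← Fintype.sum_prod_type']
  calc (∑ p : Fin (finrank ℝ E) × Fin (finrank ℝ E), G x v (e p.1) * G x w (e p.2) * β (e p.1) (e p.2)) ^ 2
      ≤ (∑ p : Fin (finrank ℝ E) × Fin (finrank ℝ E), (G x v (e p.1) * G x w (e p.2)) ^ 2)
          * ∑ p : Fin (finrank ℝ E) × Fin (finrank ℝ E), β (e p.1) (e p.2) ^ 2 :=
        Finset.sum_mul_sq_le_sq_mul_sq _ _ _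
    _ = _ := by
        rw [mul_comm]
        congr 1
        exact Finset.sum_congr rfl fun p _ ↦ by ring

/-- **Peter–Paul** from a Cauchy–Schwarz bound: `c² ≤ a b`, `a, b ≥ 0`, `λ > 0` give
`|c| ≤ ½ (λ a + λ⁻¹ b)`. [folklore] -/
theorem abs_le_peterPaul {a b c lam : ℝ} (h : c ^ 2 ≤ a * b) (ha : 0 ≤ a) (hb : 0 ≤ b)
    (hlam : 0 < lam) : |c| ≤ 2⁻¹ * (lam * a + lam⁻¹ * b) := by
  have h1 : (lam * a) * (lam⁻¹ * b) = a * b := by field_simp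
  have h2 : 0 ≤ lam * a := by positivity
  have h3 : 0 ≤ lam⁻¹ * b := by positivity
  have h4 : |c| ^ 2 ≤ (lam * a) * (lam⁻¹ * b) := by rw [h1, sq_abs]; exact h
  nlinarith [sq_nonneg (lam * a - lam⁻¹ * b), abs_nonneg c, sq_nonneg (|c| - 2⁻¹ * (lam * a + lam⁻¹ * b))]

end MetricCoord

end Literature.Geometry.Lorentzian

end
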